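import Literature.MathematicalPhysics.QuantumFieldTheory.Balaban1983to89.T4ContinuumYM4Torus
import Literature.MathematicalPhysics.QuantumFieldTheory.Balaban1983to89.Beta.DriftRemainder
import Literature.MathematicalPhysics.QuantumFieldTheory.Balaban1983to89.Beta.Assembly
import Literature.MathematicalPhysics.QuantumFieldTheory.Balaban1983to89.Beta.RateCertificate

/-!
# Gaps / WeakestBetaCurrency — skeleton SK-W of `HOME/g1/ROUTES-PLAN-2.md` (cell pub-balaban-gaps, G1, lens structural): W-β := (PS) bounded-below partial sums ∧ (UP) a uniform upper bound ∧ (C) joint continuity on ONE box — the WEAKEST β-statement the tree turns into `DagBinding.EndpointExistence`, hence into the T⁴ headline; its four QUARTER sockets; the planner's residue shapes `ResidueW ⟸ ResidueDrift ⟸ ResidueFloor`; and kernel witnesses that CAP+tail (a pointwise floor of β) is NOT on this path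

HONEST FRAMING (cell rule, page 1 of everything): the target is ONE kernel implication on ONE finite four-torus of fixed physical size — `T4ContinuumYM4Torus.continuumYM4_torus_of_endpointExistence` (:814) — whose binders are OPEN.  Nothing of Bałaban's is asserted beyond print; [Balaban1987RG1] Thm 2 is UNPROVED IN PRINT; 0∕13 main theorems and 0∕9 spine estimates are proved; this is NOT the continuum limit on ℝ⁴, NOT infinite volume, NOT a mass gap, NOT Clay.  HONEST DEPENDENCY (b2b cell, verbatim): «continuum YM on T⁴ ⇐ BetaPertH ∧ nine spine estimates (0/9 proved); BetaPertH ⇐ (D1) ∧ (D4) ∧ CAP+tail; G-an2-4 gates asym, D1 and NE2/3/4.»  THIS MODULE DISCHARGES NOTHING: every declaration is a HYPOTHESIS CARRIER (`structure` of data + hypotheses over the tree's existing predicates), a RESIDUE SHAPE (`def … : Prop` over a datum — what would have to be proved of the datum's OWN β-functions; never a fact), or a few lines of bookkeeping over theorems already in the tree: `FlowStepRuns.endpointExistence_of_partialSums` (:593), `Beta.DriftRemainder` §1∕§5, `Beta.Assembly.LimitForm`, `Beta.RateCertificate.GeomRate.drift`, `FlowStepRuns.betaAlt*`.  For Bałaban's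 family every field is a located UNPRINTED input; instance 0∕1.

WHAT IT MAKES KERNEL-EXPLICIT (ROUTES-PLAN-2 §1 row U3′, §1.1, splits S1∕S3).
  * §1 `WBeta β` = W-β: box `γ₀ > 0`; (PS) `FlowStepRuns.BetaPartialSumsLowerH M γ₀ β`; (UP) `FlowStep.BetaUpperH β' γ₀ β`; (C) `FlowStep.BetaContH γ₀ β`.  NO sign of any β_{k+1}, NO asymptotic freedom, NO rate, NO finite-k value, NO one-loop split.  The two sign side-conditions of :593 are DERIVED (`WBeta.M_nonneg`, `max β' 0`), so `WBeta.endpointExistence : ForwardGenerated C β → EndpointExistence C`; for a finite-ε datum (`D.fwd` is a FIELD) `endpointExistence_of_W`, and with (B) + the spine slot the NON-VACUOUS headline `continuumYM4Torus_of_W`.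
  * §2 `Quarters S` — the 2 × 2 table of §1.1 over the printed one-loop split `S : B12Beta.OneLoopSplit β` ((2.12)–(2.14) p. 268): (Q1) LOWER windowed drift of β⁰; (Q2) pointwise cap of β⁰; (Q3) `−r ≤ β¹` on the histories with the ONE coupling inequality `r ≤ b`; (Q4) `β¹ ≤ r'`; + (C).  `Quarters.toW` (`M = 2A`, `β' = B + r'`); `quartersOfDriftRemainder`: (D1)_weak = `Beta.Drift.OneLoopDrift b A S.β0` and (D4)_weak = `RemainderConst S γ₀ r`, `r ≤ b`, fill all four — a prover holding ONE side of (D1) or (D4) has closed a NAMED quarter.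
  * §3 `wOfLimitForm`: the CAP+tail carrier `Beta.Assembly.LimitForm` fills W-β WITHOUT its small-k list (AF-0s) — on the L1.2 path the CAP is never consumed; `w_not_pointwise`: W-β does NOT imply the sign of a single β_{k+1} (tree witness `FlowStepRuns.betaAlt` = −1, +1, −1, …) — the pointwise floor CAP+tail delivers is load-bearing ONLY for Theorem 2 AS PRINTED with (0.31) (`LimitForm.thm2Printed_of_list`, `Beta.LargeL.thm2Printed`).
  * §4 the planner's residue shapes over a datum (skeleton `HOME/g1/skeletons/SKW_WeakestBetaCurrency.lean` 1d689d438bea7782, names kept): `ResidueW D` ⟸ `ResidueDrift D` ⟸ `ResidueFloor D` (= CAP+tail currency, the binders of `Beta.RemainderConstCertified.endpointExistence_of_certifiedConst` :375 verbatim), ALL FIVE skeleton stubs PROVED (`betaUpperH_of_drift_upperOneSided`, `upperConst_nonneg_oneSided` = SK-D4r-1∕2; `oneLoopDrift_of_geomRate`, `gap_of_depth`, `r_le_binf_of_floor` = SK-W-1∕3∕2) and the chain `endpointExistence_of_residueW`, `continuumYM4_torus_of_residueW`, `residueW_of_residueDrift`, `residueDrift_of_quarters`, `residueDrift_of_drift_remainderConst`,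 `residueDrift_of_residueFloor`, `endpointExistence_of_residueFloor`, `continuumYM4_torus_of_residueDrift`: Floor ⟹ Drift ⟹ W ⟹ EndpointExistence ⟹ headline, sorry-free.
All [folklore] bookkeeping; 0 sorry; companion skeleton SK-0 = `Gaps/BetaGenericHeadline` (β-generic headline, one-exponent non-vacuity).
-/

namespace Summit.QuantumFields.BalabanUV.Gaps.WeakestBetaCurrency

open Literature.MathematicalPhysics.QuantumFieldTheory.Balaban1983to89
open Literature.MathematicalPhysics.QuantumFieldTheory.Balaban1983to89.FlowStep
open Literature.MathematicalPhysics.QuantumFieldTheory.Balaban1983to89.FlowStepRuns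
open Literature.MathematicalPhysics.QuantumFieldTheory.Balaban1983to89.DagBinding
open Literature.MathematicalPhysics.QuantumFieldTheory.Balaban1983to89.T4Continuum
open Literature.MathematicalPhysics.QuantumFieldTheory.Balaban1983to89.T4ContinuumYM4Torus
open Literature.MathematicalPhysics.QuantumFieldTheory.Balaban1983to89.Beta.Drift (OneLoopDrift)
open Literature.MathematicalPhysics.QuantumFieldTheory.Balaban1983to89.Beta.RemainderChain (RemainderConst)
open Literature.MathematicalPhysics.QuantumFieldTheory.Balaban1983to89.Beta.RateCertificate (GeomRate)

universe u

/-! ## §1 W-β: the weakest β-currency that feeds `EndpointExistence` -/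

/-- **W-β — THE WEAKEST β-CURRENCY OF RUNG L1.2** (ROUTES-PLAN-2 row U3′): for ONE history-dependent family `β : FlowStep.HBeta`, a box
size `γ₀ > 0` and: (PS) partial sums of the β's along every ]0,γ₀]-history bounded below by `−M` (`FlowStepRuns.BetaPartialSumsLowerH`, the
cell's typing of the minimal input behind the first sentence of [Balaban1987RG1] Thm 2 p. 259); (UP) a uniform upper bound `β ≤ β'` on the
boxes (`FlowStep.BetaUpperH`; PRINTED as an inductive property p. 264 «uniformly bounded»); (C) joint continuity on the boxes
(`FlowStep.BetaContH`; OPEN, b2b WALL row (D5)).  A CARRIER of data and hypotheses: nothing is asserted of Bałaban's (1.22); for his family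
(PS) is the located UNPRINTED input (fed by the drift road (D1)+(D4), §2) and the whole carrier has instance 0∕1.
[cite: Balaban1987RG1, Thm 2 p.259 (first sentence) and §1 p.264] -/
structure WBeta (β : HBeta) where
  /-- box size of all three hypotheses. -/
  γ₀ : ℝ
  γ₀_pos : 0 < γ₀
  /-- (PS) the partial-sum defect. -/
  M : ℝ
  ps : BetaPartialSumsLowerH M γ₀ β
  /-- (UP) the uniform upper constant (any real; its sign is derived where needed). -/
  β' : ℝ
  up : BetaUpperH β' γ₀ β
  /-- (C) joint continuity on the boxes. -/
  cont : BetaContH γ₀ β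

namespace WBeta

variable {β : HBeta}

/-- `0 ≤ M`: evaluate (PS) on the constant history `γ₀` with the EMPTY window `[0,0)`. [folklore] -/
theorem M_nonneg (W : WBeta β) : 0 ≤ W.M := by
  have h := W.ps (fun _ => W.γ₀) (fun _ => ⟨W.γ₀_pos, le_rfl⟩) 0 0 le_rfl
  simp at h
  linarith

/-- (UP) with the non-negative constant `max β' 0`. [folklore] -/
theorem up_max (W : WBeta β) : BetaUpperH (max W.β' 0) W.γ₀ β := fun k v hv => (W.up k v hv).trans (le_max_left _ _)

/-- **ENDPOINT EXISTENCE FROM W-β ALONE** for constructions generated forward by (0.20) from `β` — the tree's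
`FlowStepRuns.endpointExistence_of_partialSums` (:593) with both sign side-conditions derived.  No sign of any β_{k+1}, no one-loop split, no
rate, no finite-k value is consumed. [cite: Balaban1987RG1, Thm 2 p.259 (first sentence)] -/
theorem endpointExistence (W : WBeta β) {C : B12.Construction} (hgen : ForwardGenerated C β) : EndpointExistence C :=
  endpointExistence_of_partialSums hgen W.γ₀_pos W.M_nonneg (le_max_right _ _) W.cont W.ps W.up_max

end WBeta

section Datum

variable {F : T4Family} {G : Type u} [GaugeGroup G] [MeasurableSpace G] [HaarData G]

/-- **For a finite-ε datum, W-β of its β-family IS the print-faithful β-binder**: `WBeta D.βfun → EndpointExistence D.C.toB12` (forward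
generation is the datum's FIELD `D.fwd`, T4Continuum.lean). [cite: Balaban1987RG1, Thm 2 p.259 (first sentence)] -/
theorem endpointExistence_of_W (D : FiniteEpsData F G) (W : WBeta D.βfun) : EndpointExistence D.C.toB12 :=
  W.endpointExistence D.fwd

end Datum

section DatumSU

variable {F : T4Family} {N : ℕ} [NeZero N]

/-- **THE T⁴ HEADLINE IN W-β CURRENCY, NON-VACUOUS** (∀-form ∧ ∃-form): printed-averaged datum on `SU(N)`, (B), W-β of `D.βfun`, and the spine
slot under endpoint existence ⇒ `ContinuumYM4Torus D ∧ ContinuumYM4TorusE D` (= `continuumYM4_torus_of_endpointExistence_nonvacuous` :822 with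
`hEnd := endpointExistence_of_W D W`).  CAP+tail, (AF-0), (AF-1), any rate or finite-k value: NOT among the binders.  Every binder a hypothesis.
[cite: Balaban1987RG1, Thm 2 p.259] -/
theorem continuumYM4Torus_of_W (D : FiniteEpsData F (Matrix.specialUnitaryGroup (Fin N) ℂ)) (hD : D.IsPrintedAveraged)
    (hB : B16.EndStatementBPrinted D.C) (W : WBeta D.βfun)
    (hNE : T4ApexHybrid.HybridNE7Under D (EndpointExistence D.C.toB12)) : ContinuumYM4Torus D ∧ ContinuumYM4TorusE D :=
  continuumYM4_torus_of_endpointExistence_nonvacuous D hD hB (endpointExistence_of_W D W) hNE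

end DatumSU

/-! ## §2 The four QUARTER sockets over the printed one-loop split (ROUTES-PLAN-2 §1.1) -/

/-- **THE 2 × 2 TABLE OF THE DRIFT ROAD** over the printed split `β_{k+1} = β⁰_{k+1} + β¹_{k+1}(g_0,…,g_k)` ([Balaban1987RG1] (2.12)–(2.14)
p. 268, `S : B12Beta.OneLoopSplit β`): box `γ₀ > 0`; (Q1) LOWER windowed drift of the one-loop coefficients `b(n−k) − 2A ≤ Σ_{j∈[k,n)} β⁰_j`
(the lower HALF of `Beta.Drift.OneLoopDrift b A`); (Q2) a pointwise CAP `β⁰_k ≤ B` (the other half, `B = b + 2A` there); (Q3) `−r ≤ β¹` on the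
]0,γ₀]-histories with the ONE coupling inequality `r ≤ b` (the lower HALF of `Beta.RemainderChain.RemainderConst S γ₀ r` = (D4), with (D4)'s
END-grade side condition); (Q4) `β¹ ≤ r'` (the other half, any `r'`); and (C).  Hypothesis carrier; every field OPEN for Bałaban's (1.22);
nothing asserted. [cite: Balaban1987RG1, (2.12)–(2.14) p.268 and Thm 2 p.259] -/
structure Quarters {β : HBeta} (S : B12Beta.OneLoopSplit β) where
  γ₀ : ℝ
  γ₀_pos : 0 < γ₀
  /-- drift slope and defect of the one-loop coefficients (row (D1)). -/
  b : ℝ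
  A : ℝ
  /-- (Q1) LOWER windowed drift of β⁰ — feeds (PS). -/
  q1 : ∀ k n : ℕ, k ≤ n → b * ((n : ℝ) - k) - 2 * A ≤ ∑ j ∈ Finset.Ico k n, S.β0 j
  /-- (Q2) pointwise cap of β⁰ — feeds (UP). -/
  B : ℝ
  q2 : ∀ k, S.β0 k ≤ B
  /-- (Q3) one-sided LOWER remainder bound on the histories — feeds (PS); `r ≤ b` is the only coupling between the rows. -/
  r : ℝ
  q3 : ∀ k (p : Fin (k + 1) → ℝ), p ∈ B12Beta.HistBox γ₀ k → -r ≤ S.β1 k p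
  hr : r ≤ b
  /-- (Q4) one-sided UPPER remainder bound — feeds (UP). -/
  r' : ℝ
  q4 : ∀ k (p : Fin (k + 1) → ℝ), p ∈ B12Beta.HistBox γ₀ k → S.β1 k p ≤ r'
  /-- (C) joint continuity (b2b WALL row (D5)). -/
  cont : BetaContH γ₀ β

namespace Quarters

variable {β : HBeta} {S : B12Beta.OneLoopSplit β}

/-- (Q1) ∧ (Q3) ∧ `r ≤ b` ⇒ every window sum of the β's along a ]0,γ₀]-history is `≥ (b − r)(n − k) − 2A`. [folklore] -/
theorem sum_Ico_ge (Q : Quarters S) {g : ℕ → ℝ} (hg : ∀ i, 0 < g i ∧ g i ≤ Q.γ₀) {k n : ℕ} (hkn : k ≤ n) :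
    (Q.b - Q.r) * ((n : ℝ) - k) - 2 * Q.A ≤ ∑ j ∈ Finset.Ico k n, β j (prefixOf g j) := by
  have hstep : ∀ j, S.β0 j - Q.r ≤ β j (prefixOf g j) := fun j => by
    have hp : prefixOf g j ∈ B12Beta.HistBox Q.γ₀ j := fun i => hg i
    have h2 := Q.q3 j _ hp
    rw [S.split j]
    linarith
  have hsum : ∑ j ∈ Finset.Ico k n, (S.β0 j - Q.r) ≤ ∑ j ∈ Finset.Ico k n, β j (prefixOf g j) :=
    Finset.sum_le_sum fun j _ => hstep j
  have hsplit : ∑ j ∈ Finset.Ico k n, (S.β0 j - Q.r) = ∑ j ∈ Finset.Ico k n, S.β0 j - Q.r * ((n : ℝ) - k) := by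
    rw [Finset.sum_sub_distrib, Finset.sum_const, Nat.card_Ico, nsmul_eq_mul, Nat.cast_sub hkn]
    ring
  have hdr := Q.q1 k n hkn
  nlinarith [hsum, hsplit, hdr]

/-- **(PS) FROM THE TWO LOWER QUARTERS**: `BetaPartialSumsLowerH (2A) γ₀ β`. [cite: Balaban1987RG1, Thm 2 p.259 (first sentence)] -/
theorem partialSums (Q : Quarters S) : BetaPartialSumsLowerH (2 * Q.A) Q.γ₀ β := by
  intro g hg k n hkn
  have h := Q.sum_Ico_ge hg hkn
  have hnk : (0 : ℝ) ≤ (n : ℝ) - k := by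
    have : (k : ℝ) ≤ n := by exact_mod_cast hkn
    linarith
  nlinarith [h, hnk, Q.hr]

/-- **(UP) FROM THE TWO UPPER QUARTERS**: `BetaUpperH (B + r') γ₀ β`. [cite: Balaban1987RG1, §1 p.264] -/
theorem upper (Q : Quarters S) : BetaUpperH (Q.B + Q.r') Q.γ₀ β := by
  intro k v hv
  have h1 := Q.q4 k v (histBox_of_mem_box hv)
  have h0 := Q.q2 k
  rw [S.split k]
  linarith

/-- **THE QUARTERS FILL W-β** (`M = 2A`, `β' = B + r'`). [folklore] -/
def toW (Q : Quarters S) : WBeta β where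
  γ₀ := Q.γ₀
  γ₀_pos := Q.γ₀_pos
  M := 2 * Q.A
  ps := Q.partialSums
  β' := Q.B + Q.r'
  up := Q.upper
  cont := Q.cont

/-- Endpoint existence from the quarters (forward-generated constructions). [cite: Balaban1987RG1, Thm 2 p.259 (first sentence)] -/
theorem endpointExistence (Q : Quarters S) {C : B12.Construction} (hgen : ForwardGenerated C β) :
    EndpointExistence C :=
  Q.toW.endpointExistence hgen

end Quarters

/-- **(D1)_weak ∧ (D4)_weak ∧ `r ≤ b` ∧ (C) FILL ALL FOUR QUARTERS**: the drift form `OneLoopDrift b A S.β0` (row (D1) at END grade, b2b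
`Beta.OneStepKernelFamily.D1Drift` unfolds to it with `b = stepBal N Lc`) gives (Q1) (`Beta.Drift.sum_Ico_ge_of_drift`) and (Q2) with `B = b + 2A`
(`Beta.DriftRemainder.abs_beta0_sub_le_of_drift`); the constant-form remainder bound `RemainderConst S γ₀ r` (row (D4), END
`Beta.RemainderDecay190.ChainTFac190.abs_beta1_le`) gives (Q3)∕(Q4) with `r' = r`.  Bookkeeping; both inputs OPEN for Bałaban's family.
[cite: Balaban1987RG1, (1.22) p.264 and (2.12)–(2.14) p.268] -/
def quartersOfDriftRemainder {β : HBeta} (S : B12Beta.OneLoopSplit β) {γ₀ b A r : ℝ} (hγ₀ : 0 < γ₀)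
    (hdrift : OneLoopDrift b A S.β0) (hrem : RemainderConst S γ₀ r) (hr : r ≤ b) (hcont : BetaContH γ₀ β) : Quarters S where
  γ₀ := γ₀
  γ₀_pos := hγ₀
  b := b
  A := A
  q1 := fun _ _ hkn => Beta.Drift.sum_Ico_ge_of_drift hdrift hkn
  B := b + 2 * A
  q2 := fun k => by
    have h := (abs_le.mp (Beta.DriftRemainder.abs_beta0_sub_le_of_drift hdrift k)).2
    linarith
  r := r
  q3 := fun k p hp => (abs_le.mp (hrem k p hp)).1
  hr := hr
  r' := r
  q4 := fun k p hp => (abs_le.mp (hrem k p hp)).2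
  cont := hcont

/-! ## §3 CAP+tail is not on this path: the limit-form carrier fills W-β without its small-k list, and W-β has no pointwise sign -/

/-- **THE CAP+tail CARRIER MINUS THE CAP FILLS W-β**: the β sub-cell's `Beta.Assembly.LimitForm β` ((AF-0∞) `0 < β⁰_∞`, (AF-0r) the tail rate
`|β⁰_{k+1} − β⁰_∞| ≤ c₀θ^k`, (AF-1), (C), (U)) gives W-β on its explicit box `γ₁` with `M = c₀∕(1−θ)` — by `LimitForm.partialSums_γ₁`, i.e. with NO
finite list (AF-0s) of small-k signs (the CAP).  The CAP is consumed only by `LimitForm.thm2Printed_of_list` (Theorem 2 AS PRINTED, (0.31)).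
[cite: Balaban1987RG1, Thm 2 p.259 and (0.31)] -/
noncomputable def wOfLimitForm {β : HBeta} (D : Beta.Assembly.LimitForm β) : WBeta β where
  γ₀ := D.γ₁
  γ₀_pos := D.γ₁_pos
  M := D.M
  ps := D.partialSums_γ₁
  β' := D.β'
  up := D.upper_mono D.γ₁_le
  cont := D.cont_mono D.γ₁_le

/-- **W-β DOES NOT GIVE THE SIGN OF A SINGLE β_{k+1}** (so no pointwise floor, no (0.31)-type lower bound): the tree's alternating family
`FlowStepRuns.betaAlt` (−1, +1, −1, …; constant in the history) carries W-β on every box (`M = β' = 1`; this carrier) and violates `0 ≤ β` at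
step 0 (`w_not_pointwise`).  Hence whatever CAP+tail adds beyond W-β is invisible to rung L1.2. [folklore] -/
def wBetaAlt {γ : ℝ} (hγ : 0 < γ) : WBeta betaAlt where
  γ₀ := γ
  γ₀_pos := hγ
  M := 1
  ps := betaAlt_partialSumsLower γ
  β' := 1
  up := betaAlt_upper γ
  cont := betaAlt_cont γ

/-- W-β holds for `betaAlt` on every box, yet the sign fails (at step 0). [folklore] -/
theorem w_not_pointwise {γ : ℝ} (hγ : 0 < γ) : Nonempty (WBeta betaAlt) ∧ ¬ BetaLowerH 0 γ betaAlt :=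
  ⟨Nonempty.intro (wBetaAlt hγ), betaAlt_not_sign hγ⟩

/-- … while its canonical forward-generated construction still has endpoint existence (through W-β). [folklore] -/
theorem betaAlt_endpointExistence {γ : ℝ} (hγ : 0 < γ) : EndpointExistence (modelOf betaAlt) :=
  (wBetaAlt hγ).endpointExistence (modelOf_forwardGenerated betaAlt)

/-! ## §4 The planner's residue shapes over a datum: `ResidueW ⟸ ResidueDrift ⟸ ResidueFloor` (skeleton SK-W names; all stubs proved) -/

section Residues

variable {F : T4Family} {N : ℕ} [NeZero N]

/-- **W-β AS A RESIDUE SHAPE OF THE DATUM** (ROUTES-PLAN-2 U3′): on ONE box `]0,γ₀]`, (PS) windowed partial sums of the datum's β-functions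
along `]0,γ₀]`-histories are `≥ −M`, (UP) `β ≤ β'`, (C) each `β k` continuous on the box — exactly the binders of
`FlowStepRuns.endpointExistence_of_partialSums` (:593) beyond forward generation (the datum's FIELD `D.fwd`).  `Nonempty (WBeta D.βfun)` is
equivalent (`residueW_iff_nonempty_wBeta`).  RESIDUE ∕ HYPOTHESIS SHAPE for Bałaban's family, never a fact; instance 0∕1.
[cite: Balaban1987RG1, Thm 2 p.259 (first sentence) and §1 p.264] -/
def ResidueW (D : FiniteEpsData F (Matrix.specialUnitaryGroup (Fin N) ℂ)) : Prop :=
  ∃ γ₀ M β' : ℝ, 0 < γ₀ ∧ 0 ≤ M ∧ 0 ≤ β' ∧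
    BetaPartialSumsLowerH M γ₀ D.βfun ∧ BetaUpperH β' γ₀ D.βfun ∧ BetaContH γ₀ D.βfun

/-- **THE DRIFT ROAD, ONE-SIDED** ((D1)_weak ∧ (D4)_weak): a one-loop split `S` of `D.βfun` ((2.12)–(2.14) p. 268), a cumulative DRIFT of
`S.β0` with SOME slope `b` and defect `A` (`Beta.Drift.OneLoopDrift`), a ONE-SIDED k-uniform lower bound `−r ≤ S.β1` on the histories with
`r ≤ b`, (UP) and (C).  Of the value of `b` only `r ≤ b` is load-bearing.  RESIDUE SHAPE, never a fact.
[cite: Balaban1987RG1, (2.12)–(2.14) p.268 and Thm 2 p.259] -/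
def ResidueDrift (D : FiniteEpsData F (Matrix.specialUnitaryGroup (Fin N) ℂ)) : Prop :=
  ∃ (S : B12Beta.OneLoopSplit D.βfun) (γ₀ b A r β' : ℝ), 0 < γ₀ ∧ 0 ≤ β' ∧
    OneLoopDrift b A S.β0 ∧
    (∀ k (p : Fin (k + 1) → ℝ), p ∈ B12Beta.HistBox γ₀ k → -r ≤ S.β1 k p) ∧ r ≤ b ∧
    BetaUpperH β' γ₀ D.βfun ∧ BetaContH γ₀ D.βfun

/-- **THE FLOOR ROAD = CAP + TAIL CURRENCY** — the binders of `Beta.RemainderConstCertified.endpointExistence_of_certifiedConst` (:375)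
verbatim: (tail) a geometric RATE `GeomRate S.β0 binf c₀ θ` (`0 ≤ θ < 1`), (cap) ONE certified value `m ≤ S.β0 k₁` and the depth clause
`c₀θ^{k₂} ≤ (m − c₀θ^{k₁})/4`, the two-sided constant-form remainder `RemainderConst S γ₀ r` with `r < 3(m − c₀θ^{k₁})/4`, (UP), `−β' ≤ β`,
(C).  RESIDUE SHAPE, never a fact; for Bałaban's family: cap = certified numerics at the construction's own `L` (b2b row CAP-k, 0
coefficients certified), tail = G-an2-4 (CONV-C), OPEN. [cite: Balaban1987RG1, (1.22) p.264 and Thm 2 (0.31) p.259] -/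
def ResidueFloor (D : FiniteEpsData F (Matrix.specialUnitaryGroup (Fin N) ℂ)) : Prop :=
  ∃ (S : B12Beta.OneLoopSplit D.βfun) (γ₀ binf c₀ θ r β' m : ℝ) (k₁ k₂ : ℕ), 0 < γ₀ ∧ 0 ≤ θ ∧ θ < 1 ∧
    GeomRate S.β0 binf c₀ θ ∧ m ≤ S.β0 k₁ ∧ c₀ * θ ^ k₂ ≤ (m - c₀ * θ ^ k₁) / 4 ∧
    RemainderConst S γ₀ r ∧ r < 3 * (m - c₀ * θ ^ k₁) / 4 ∧
    BetaUpperH β' γ₀ D.βfun ∧ (∀ k, ∀ v ∈ Box γ₀ k, -β' ≤ D.βfun k v) ∧ BetaContH γ₀ D.βfun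

/-- `ResidueW D` is inhabitation of the carrier `WBeta D.βfun` (the carrier derives the two sign side-conditions). [folklore] -/
theorem residueW_iff_nonempty_wBeta (D : FiniteEpsData F (Matrix.specialUnitaryGroup (Fin N) ℂ)) :
    ResidueW D ↔ Nonempty (WBeta D.βfun) := by
  constructor
  · rintro ⟨γ₀, M, β', hγ₀, -, -, hPS, hUP, hC⟩
    exact ⟨{ γ₀ := γ₀, γ₀_pos := hγ₀, M := M, ps := hPS, β' := β', up := hUP, cont := hC }⟩
  · rintro ⟨W⟩
    exact ⟨W.γ₀, W.M, max W.β' 0, W.γ₀_pos, W.M_nonneg, le_max_right _ _, W.ps, W.up_max, W.cont⟩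

/-- **W-β ⟹ ENDPOINT EXISTENCE** for the datum's construction (`FlowStepRuns.endpointExistence_of_partialSums` at `D.fwd`).
[cite: Balaban1987RG1, Thm 2 p.259 (first sentence)] -/
theorem endpointExistence_of_residueW (D : FiniteEpsData F (Matrix.specialUnitaryGroup (Fin N) ℂ)) (h : ResidueW D) :
    EndpointExistence D.C.toB12 := by
  obtain ⟨γ₀, M, β', hγ₀, hM, hβ', hPS, hUP, hC⟩ := h
  exact endpointExistence_of_partialSums D.fwd hγ₀ hM hβ' hC hPS hUP

/-- **THE HEADLINE + ITS ∃-READING FROM W-β** (with (B) and the spine slot under endpoint existence). [cite: Balaban1987RG1, Thm 2 p.259] -/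
theorem continuumYM4_torus_of_residueW (D : FiniteEpsData F (Matrix.specialUnitaryGroup (Fin N) ℂ))
    (hD : D.IsPrintedAveraged) (hB : B16.EndStatementBPrinted D.C) (hW : ResidueW D)
    (hNE : T4ApexHybrid.HybridNE7Under D (EndpointExistence D.C.toB12)) :
    ContinuumYM4Torus D ∧ ContinuumYM4TorusE D :=
  continuumYM4_torus_of_endpointExistence_nonvacuous D hD hB (endpointExistence_of_residueW D hW) hNE

/-- **DRIFT ROAD ⟹ W-β**: (PS) from the drift's LOWER half + the one-sided `−r ≤ β¹` + `r ≤ b`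
(`DriftRemainder.betaPartialSumsLowerH_of_drift_oneSided`, constant `2A`); (UP) and (C) carried. [folklore] -/
theorem residueW_of_residueDrift (D : FiniteEpsData F (Matrix.specialUnitaryGroup (Fin N) ℂ)) (h : ResidueDrift D) :
    ResidueW D := by
  obtain ⟨S, γ₀, b, A, r, β', hγ₀, hβ', hdrift, hlow, hr, hUP, hC⟩ := h
  exact ⟨γ₀, 2 * A, β', hγ₀, by linarith [hdrift.nonneg], hβ',
    Beta.DriftRemainder.betaPartialSumsLowerH_of_drift_oneSided S hdrift hlow hr, hUP, hC⟩

/-- Skeleton stub SK-D4r-1, PROVED: the UPPER quarter — the drift's upper half caps `β⁰_k ≤ b + 2A` and a one-sided `β¹ ≤ r'` on the histories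
give (UP) with `β' = b + 2A + r'` (= the tree's `DriftRemainder.betaUpperH_of_drift_oneSided`). [folklore] -/
theorem betaUpperH_of_drift_upperOneSided {β : HBeta} (S : B12Beta.OneLoopSplit β) {b A r' γ₀ : ℝ}
    (hdrift : OneLoopDrift b A S.β0)
    (hup1 : ∀ k (p : Fin (k + 1) → ℝ), p ∈ B12Beta.HistBox γ₀ k → S.β1 k p ≤ r') :
    BetaUpperH (b + 2 * A + r') γ₀ β :=
  Beta.DriftRemainder.betaUpperH_of_drift_oneSided S hdrift hup1

/-- Skeleton stub SK-D4r-2, PROVED: the sign of the derived upper constant from one-sided data (evaluate both one-sided bounds at the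
constant history `γ₀`, scale 0: `−r ≤ β¹ ≤ r'`, and `|β⁰_0 − b| ≤ 2A`, `r ≤ b`). [folklore] -/
theorem upperConst_nonneg_oneSided {β : HBeta} (S : B12Beta.OneLoopSplit β) {b A r r' γ₀ : ℝ} (hγ₀ : 0 < γ₀)
    (hdrift : OneLoopDrift b A S.β0)
    (hlow : ∀ k (p : Fin (k + 1) → ℝ), p ∈ B12Beta.HistBox γ₀ k → -r ≤ S.β1 k p)
    (hup1 : ∀ k (p : Fin (k + 1) → ℝ), p ∈ B12Beta.HistBox γ₀ k → S.β1 k p ≤ r') (hr : r ≤ b) :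
    0 ≤ b + 2 * A + r' := by
  have hp : (fun _ : Fin (0 + 1) => γ₀) ∈ B12Beta.HistBox γ₀ 0 := fun _ => ⟨hγ₀, le_rfl⟩
  have h1 := hlow 0 _ hp
  have h2 := hup1 0 _ hp
  linarith [hdrift.nonneg]

/-- **THE FOUR QUARTERS ⟹ THE DRIFT ROAD**: drift (both halves of β⁰), `−r ≤ β¹`, `β¹ ≤ r'`, `r ≤ b`, (C) — (UP) DERIVED, so the (D4)
residue may be filed as two one-sided k-uniform bounds. [folklore] -/
theorem residueDrift_of_quarters (D : FiniteEpsData F (Matrix.specialUnitaryGroup (Fin N) ℂ))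
    (S : B12Beta.OneLoopSplit D.βfun) {γ₀ b A r r' : ℝ} (hγ₀ : 0 < γ₀) (hdrift : OneLoopDrift b A S.β0)
    (hlow : ∀ k (p : Fin (k + 1) → ℝ), p ∈ B12Beta.HistBox γ₀ k → -r ≤ S.β1 k p)
    (hup1 : ∀ k (p : Fin (k + 1) → ℝ), p ∈ B12Beta.HistBox γ₀ k → S.β1 k p ≤ r') (hr : r ≤ b)
    (hC : BetaContH γ₀ D.βfun) : ResidueDrift D :=
  ⟨S, γ₀, b, A, r, b + 2 * A + r', hγ₀, upperConst_nonneg_oneSided S hγ₀ hdrift hlow hup1 hr, hdrift, hlow, hr,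
    betaUpperH_of_drift_upperOneSided S hdrift hup1, hC⟩

/-- The tree's END-grade socket is an instance: drift (ANY slope `b`) + two-sided `RemainderConst S γ₀ r` + `r ≤ b` + (C) ⟹ `ResidueDrift D`.
[folklore] -/
theorem residueDrift_of_drift_remainderConst (D : FiniteEpsData F (Matrix.specialUnitaryGroup (Fin N) ℂ))
    (S : B12Beta.OneLoopSplit D.βfun) {γ₀ b A r : ℝ} (hγ₀ : 0 < γ₀) (hdrift : OneLoopDrift b A S.β0)
    (hrem : RemainderConst S γ₀ r) (hr : r ≤ b) (hC : BetaContH γ₀ D.βfun) : ResidueDrift D :=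
  ⟨S, γ₀, b, A, r, b + 2 * A + r, hγ₀, Beta.DriftRemainder.upperConst_nonneg hγ₀ hdrift hrem hr, hdrift,
    fun k p hp => (abs_le.mp (hrem k p hp)).1, hr, Beta.DriftRemainder.betaUpperH_of_drift_remainderConst S hdrift hrem, hC⟩

/-- Skeleton stub SK-W-1, PROVED (it is the tree's `RateCertificate.GeomRate.drift` ∘ `Drift.drift_of_geometric`): a geometric rate gives the
cumulative drift with slope `b_∞` and defect `c₀/(1−θ)`. [folklore] -/
theorem oneLoopDrift_of_geomRate {b : ℕ → ℝ} {binf c₀ θ : ℝ} (hθ0 : 0 ≤ θ) (hθ1 : θ < 1) (hconv : GeomRate b binf c₀ θ) :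
    OneLoopDrift binf (c₀ / (1 - θ)) b :=
  hconv.drift hθ0 hθ1

/-- Skeleton stub SK-W-3, PROVED: the floor's depth clause forces `c₀θ^{k₁} ≤ m` (`0 ≤ c₀` comes free from `GeomRate` at `k = 0`,
`RateCertificate.GeomRate.const_nonneg`; then `0 ≤ c₀θ^{k₂} ≤ (m − c₀θ^{k₁})/4`). [folklore] -/
theorem gap_of_depth {b : ℕ → ℝ} {binf c₀ θ m : ℝ} {k₁ k₂ : ℕ} (hθ0 : 0 ≤ θ) (_hθ1 : θ < 1) (hconv : GeomRate b binf c₀ θ)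
    (hk₂ : c₀ * θ ^ k₂ ≤ (m - c₀ * θ ^ k₁) / 4) : c₀ * θ ^ k₁ ≤ m := by
  have hc : 0 ≤ c₀ := hconv.const_nonneg
  have h2 : 0 ≤ c₀ * θ ^ k₂ := mul_nonneg hc (pow_nonneg hθ0 _)
  linarith

/-- Skeleton stub SK-W-2, PROVED: under the floor data the remainder constant is below the tail slope: `b_∞ ≥ β⁰_{k₁} − c₀θ^{k₁} ≥ m − c₀θ^{k₁}`
and `r < 3(m − c₀θ^{k₁})/4 ≤ m − c₀θ^{k₁}`. [folklore] -/
theorem r_le_binf_of_floor {b : ℕ → ℝ} {binf c₀ θ r m : ℝ} {k₁ : ℕ} (_hθ0 : 0 ≤ θ) (_hθ1 : θ < 1) (hconv : GeomRate b binf c₀ θ)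
    (hcert : m ≤ b k₁) (hr : r < 3 * (m - c₀ * θ ^ k₁) / 4) (hk : c₀ * θ ^ k₁ ≤ m) : r ≤ binf := by
  have h1 := (abs_le.mp (hconv k₁)).2
  linarith

/-- **FLOOR ROAD ⟹ DRIFT ROAD**: CAP+tail data give the drift road with slope `b_∞`; so CAP+tail is NOT needed by anything downstream of
`ResidueDrift` — in particular not by the T⁴ headline. [folklore] -/
theorem residueDrift_of_residueFloor (D : FiniteEpsData F (Matrix.specialUnitaryGroup (Fin N) ℂ)) (h : ResidueFloor D) :
    ResidueDrift D := by
  obtain ⟨S, γ₀, binf, c₀, θ, r, β', m, k₁, k₂, hγ₀, hθ0, hθ1, hconv, hcert, hk₂, hrem, hr, hUP, hlo, hC⟩ := h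
  have hgap := gap_of_depth hθ0 hθ1 hconv hk₂
  have hβ' : 0 ≤ β' := by
    have h1 := hlo 0 (fun _ => γ₀) (mem_box.mpr fun _ => ⟨hγ₀, le_rfl⟩)
    have h2 := hUP 0 (fun _ => γ₀) (mem_box.mpr fun _ => ⟨hγ₀, le_rfl⟩)
    linarith
  exact ⟨S, γ₀, binf, c₀ / (1 - θ), r, β', hγ₀, hβ', oneLoopDrift_of_geomRate hθ0 hθ1 hconv,
    fun k p hp => (abs_le.mp (hrem k p hp)).1, r_le_binf_of_floor hθ0 hθ1 hconv hcert hr hgap, hUP, hC⟩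

/-- **FLOOR ⟹ DRIFT ⟹ W ⟹ ENDPOINT EXISTENCE** (by name). [cite: Balaban1987RG1, Thm 2 p.259 (first sentence)] -/
theorem endpointExistence_of_residueFloor (D : FiniteEpsData F (Matrix.specialUnitaryGroup (Fin N) ℂ)) (h : ResidueFloor D) :
    EndpointExistence D.C.toB12 :=
  endpointExistence_of_residueW D (residueW_of_residueDrift D (residueDrift_of_residueFloor D h))

/-- **THE HEADLINE FROM THE DRIFT ROAD** (the currency the G1 residues are filed in). [cite: Balaban1987RG1, Thm 2 p.259] -/
theorem continuumYM4_torus_of_residueDrift (D : FiniteEpsData F (Matrix.specialUnitaryGroup (Fin N) ℂ))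
    (hD : D.IsPrintedAveraged) (hB : B16.EndStatementBPrinted D.C) (h : ResidueDrift D)
    (hNE : T4ApexHybrid.HybridNE7Under D (EndpointExistence D.C.toB12)) :
    ContinuumYM4Torus D ∧ ContinuumYM4TorusE D :=
  continuumYM4_torus_of_residueW D hD hB (residueW_of_residueDrift D h) hNE

end Residues

end Summit.QuantumFields.BalabanUV.Gaps.WeakestBetaCurrency
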